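import Mathlib
import HarnessLib
import Literature.MathematicalPhysics.StatisticalMechanics.TorusFRDKernelComparisonShell

/-!
# Shell-wise SECOND differences of the multipliers `𝒞̂_{A,k}(κ)` along lines of coefficient matrices
# (clause (v) of `TorusFRD` with `ℓ = 2`): the kernel input of the `ℓ = 2` Hilbert–Schmidt comparison

`TorusFRDKernelComparisonShell` turns the FIRST multiplier derivative bound of clause (v) into the shell-wise
relative closeness `|Re 𝒞̂_{1+q',k}(κ) − Re 𝒞̂_{1+q,k}(κ)| ≤ ρ_j(κ)·Re 𝒞̂(κ)`.  Here the SECOND derivative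
bound (`ℓ = 2` in clause (v)) is integrated twice along a line `A₀ + sB`, `s ∈ [0, 2T]`:

* `norm_line_secondDiff_le` — real analysis in a normed space: `‖f(2t) − 2f(t) + f(0)‖ ≤ D t²` when
  `‖f''‖ ≤ D` on `[0,2t]`;
* `norm_fourierCoeff_segment_secondDiff_le` — for a kernel family `A ↦ 𝒦_A` smooth along the segment with
  `‖∂²_s 𝒦̂_{A₀+uB+sB}(κ)|_{s=0}‖ ≤ D`:  `‖𝒦̂_{A₀+2tB}(κ) − 2𝒦̂_{A₀+tB}(κ) + 𝒦̂_{A₀}(κ)‖ ≤ D t²`;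
* **`norm_fourierCoeff_secondDiff_le_shell_of_torusFRD`** — for the torus package, `κ ≠ 0` in shell `j`,
  an elliptic segment `A₀ + sB`, `s ∈ [0,2T]`, `1 ≤ k ≤ N+1`, and EVERY `v ∈ [0, 2T]`:
  `‖𝒞̂_{A₀+2TB,k}(κ) − 2𝒞̂_{A₀+TB,k}(κ) + 𝒞̂_{A₀,k}(κ)‖ ≤ (K⁽²⁾_j · T²) · Re 𝒞̂_{A₀+vB,k}(κ)` with the
  shell-wise ratio `K⁽²⁾_j = shellRatioConst c (Cℓ 2) L d ñ / L^{(k−j)(ñ−n)}` (no exponential: the shell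
  lower bound of clause (v) holds at every elliptic point);
* **`norm_fourierCoeff_one_add_line_secondDiff_le_shell_of_torusFRD`** — the same for the line
  `1+q, 1+q+h, 1+q+2h` of symmetric tuning parameters in the ball `Σ|·| ≤ ½`, `T = Σ|h|`, relative to
  `Re 𝒞̂` at each of the three points.

This is the multiplier input (`ρ⁽²⁾_j(κ) = K⁽²⁾_j T²`, square-summable over shells exactly like `ρ_j`) of
the second-order kernel comparison in the `ℓ = 2` q-slots of [ABKM19] Lemma 12.6.  Everything is proved.

## References
* S. Buchholz, *Finite range decomposition for Gaussian measures with improved regularity*,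
  J. Funct. Anal. 275 (2018) 1674–1711, Thm 2.4 / Thm 4.5 (proof) [Buchholz2016].
* S. Adams, S. Buchholz, R. Kotecký, S. Müller, arXiv:1910.13564, Theorem 6.1 (iv),(v), Lemma 7.7, Lemma 12.6
  [AdamsBuchholzKoteckyMuller2019].
-/

noncomputable section

namespace Literature.MathematicalPhysics.StatisticalMechanics.GradientRG

open Real Set Finset
open Literature.MathematicalPhysics.StatisticalMechanics.GradientFRD
  (fourierCoeff IsElliptic IsUnitSymm InShell iterDiff fourierCoeff_eq_sum)
open Literature.Probability.LatticeModels (torusChar)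

variable {d M : ℕ} [NeZero M]

/-! ## Real analysis: second differences along a line, normed-space valued -/

omit [NeZero M] in
/-- `‖f(2t) − 2f(t) + f(0)‖ ≤ D t²` if `f : ℝ → F` is differentiable on `[0,2t]` with derivative `f'`, `f'` is
differentiable there with derivative `f''`, and `‖f''‖ ≤ D`. [cite: AdamsBuchholzKoteckyMuller2019, Lemma 12.6 (12.51)] -/
theorem norm_line_secondDiff_le {F : Type*} [NormedAddCommGroup F] [NormedSpace ℝ F] {f f' f'' : ℝ → F}
    {t D : ℝ} (ht : 0 ≤ t)
    (hf : ∀ u ∈ Icc 0 (2 * t), HasDerivAt f (f' u) u) (hf' : ∀ u ∈ Icc 0 (2 * t), HasDerivAt f' (f'' u) u)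
    (hbound : ∀ u ∈ Icc 0 (2 * t), ‖f'' u‖ ≤ D) :
    ‖f (2 * t) - (2 : ℝ) • f t + f 0‖ ≤ D * t ^ 2 := by
  -- the derivative is `D t`-Lipschitz over a step `t` inside `[0, 2t]`
  have hstep : ∀ u ∈ Icc 0 t, ‖f' (u + t) - f' u‖ ≤ D * t := by
    intro u hu
    have hderivW : ∀ v ∈ Icc u (u + t), HasDerivWithinAt f' (f'' v) (Icc u (u + t)) v :=
      fun v hv => (hf' v ⟨hu.1.trans hv.1, by linarith [hv.2, hu.2]⟩).hasDerivWithinAt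
    have hboundW : ∀ v ∈ Ico u (u + t), ‖f'' v‖ ≤ D := fun v hv =>
      hbound v ⟨hu.1.trans hv.1, by linarith [hv.2, hu.2]⟩
    have h := norm_image_sub_le_of_norm_deriv_le_segment' hderivW hboundW (u + t) (right_mem_Icc.2 (by linarith))
    rw [add_sub_cancel_left] at h
    exact h
  -- `g(u) = f(u+t) − f(u)` on `[0, t]`
  set g : ℝ → F := fun u => f (u + t) - f u with hg
  have hgderiv : ∀ u ∈ Icc 0 t, HasDerivWithinAt g (f' (u + t) - f' u) (Icc 0 t) u := by
    intro u hu
    have h1 : HasDerivAt (fun u => f (u + t)) (f' (u + t)) u := by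
      have := hf (u + t) ⟨by linarith [hu.1], by linarith [hu.2]⟩
      exact this.comp_add_const u t
    have h2 : HasDerivAt f (f' u) u := hf u ⟨hu.1, by linarith [hu.2]⟩
    exact (h1.sub h2).hasDerivWithinAt
  have hgbound : ∀ u ∈ Ico 0 t, ‖f' (u + t) - f' u‖ ≤ D * t := fun u hu => hstep u (Ico_subset_Icc_self hu)
  have h := norm_image_sub_le_of_norm_deriv_le_segment' hgderiv hgbound t (right_mem_Icc.2 ht)
  rw [sub_zero] at h
  have e : g t - g 0 = f (2 * t) - (2 : ℝ) • f t + f 0 := by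
    simp only [hg, zero_add, two_smul]
    rw [show t + t = 2 * t by ring]
    abel
  rw [e] at h
  calc ‖f (2 * t) - (2 : ℝ) • f t + f 0‖ ≤ D * t * t := h
    _ = D * t ^ 2 := by ring

/-! ## Second differences of `𝒦̂` along a segment of coefficient matrices -/

/-- **Second-order step along a segment for the multipliers**: if for every `u ∈ [0,2t]` the real-space
values `s ↦ 𝒦_{A₀+uB+sB}(y)` are smooth on an open interval around `0` (all `y`) and
`‖∂²_s 𝒦̂_{A₀+uB+sB}(κ)|_{s=0}‖ ≤ D`, then `‖𝒦̂_{A₀+2tB}(κ) − 2𝒦̂_{A₀+tB}(κ) + 𝒦̂_{A₀}(κ)‖ ≤ D t²`.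
[cite: AdamsBuchholzKoteckyMuller2019, Theorem 6.1 (v) / Lemma 7.7] -/
theorem norm_fourierCoeff_segment_secondDiff_le {𝒦 : Matrix (Fin d) (Fin d) ℝ → (Fin d → ZMod M) → ℝ}
    {A₀ B : Matrix (Fin d) (Fin d) ℝ} {t D : ℝ} (ht : 0 ≤ t) (κ : Fin d → ZMod M)
    (hsmooth : ∀ u ∈ Icc 0 (2 * t), ∃ ε : ℝ, 0 < ε ∧ ∀ y,
      ContDiffOn ℝ ⊤ (fun s : ℝ => 𝒦 (A₀ + u • B + s • B) y) (Ioo (-ε) ε))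
    (hbound : ∀ u ∈ Icc 0 (2 * t),
      ‖iteratedDeriv 2 (fun s : ℝ => fourierCoeff (𝒦 (A₀ + u • B + s • B)) κ) 0‖ ≤ D) :
    ‖fourierCoeff (𝒦 (A₀ + (2 * t) • B)) κ - 2 * fourierCoeff (𝒦 (A₀ + t • B)) κ + fourierCoeff (𝒦 A₀) κ‖ ≤
      D * t ^ 2 := by
  set f : ℝ → ℂ := fun u => fourierCoeff (𝒦 (A₀ + u • B)) κ with hf
  -- `f` is smooth on an open neighbourhood of every point of `[0, 2t]`
  have hloc : ∀ u ∈ Icc 0 (2 * t), ∃ ε : ℝ, 0 < ε ∧ ContDiffOn ℝ ⊤ f (Ioo (u - ε) (u + ε)) := by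
    intro u hu
    obtain ⟨ε, hε, hcd⟩ := hsmooth u hu
    refine ⟨ε, hε, ?_⟩
    set Fu : ℝ → ℂ := fun s => fourierCoeff (𝒦 (A₀ + u • B + s • B)) κ with hFu
    have hFcd : ContDiffOn ℝ ⊤ Fu (Ioo (-ε) ε) := by
      have : Fu = fun s => ∑ x : Fin d → ZMod M,
          ((𝒦 (A₀ + u • B + s • B) x : ℝ) : ℂ) * (starRingEnd ℂ) (torusChar κ x) := by
        funext s; rw [hFu]; exact fourierCoeff_eq_sum _ κ
      rw [this]
      refine ContDiffOn.sum fun x _ => ?_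
      exact (Complex.ofRealCLM.contDiff.comp_contDiffOn (hcd x)).mul contDiffOn_const
    have hfF : ∀ v, f v = Fu (v - u) := by
      intro v; simp only [hf, hFu]; congr 2; rw [add_assoc, ← add_smul, add_sub_cancel]
    have hfeq : f = Fu ∘ fun v => v - u := funext fun v => hfF v
    rw [hfeq]
    refine hFcd.comp (contDiffOn_id.sub contDiffOn_const) fun v hv => ?_
    simp only [Set.mem_Ioo] at hv ⊢
    constructor <;> linarith [hv.1, hv.2]
  -- derivatives of `f` on `[0, 2t]`
  have hderiv : ∀ u ∈ Icc 0 (2 * t), HasDerivAt f (deriv f u) u ∧ HasDerivAt (deriv f) (deriv (deriv f) u) u := by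
    intro u hu
    obtain ⟨ε, hε, hcd⟩ := hloc u hu
    have hopen : IsOpen (Ioo (u - ε) (u + ε)) := isOpen_Ioo
    have hmem : Ioo (u - ε) (u + ε) ∈ nhds u := hopen.mem_nhds ⟨by linarith, by linarith⟩
    have h1 : DifferentiableAt ℝ f u := (hcd.differentiableOn (by simp)).differentiableAt hmem
    have hcd' : ContDiffOn ℝ ⊤ (deriv f) (Ioo (u - ε) (u + ε)) :=
      hcd.deriv_of_isOpen hopen (by simp)
    have h2 : DifferentiableAt ℝ (deriv f) u := (hcd'.differentiableOn (by simp)).differentiableAt hmem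
    exact ⟨h1.hasDerivAt, h2.hasDerivAt⟩
  -- the second derivative of `f` at `u` is the rebased `iteratedDeriv 2` at `0`
  have hsecond : ∀ u, deriv (deriv f) u =
      iteratedDeriv 2 (fun s : ℝ => fourierCoeff (𝒦 (A₀ + u • B + s • B)) κ) 0 := by
    intro u
    have hF : (fun s : ℝ => fourierCoeff (𝒦 (A₀ + u • B + s • B)) κ) = fun s => f (s + u) := by
      funext s; simp only [hf]; congr 2; rw [add_assoc, ← add_smul, add_comm u s]
    rw [hF, iteratedDeriv_succ, iteratedDeriv_one]
    have hd1 : deriv (fun s => f (s + u)) = fun s => deriv f (s + u) := by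
      funext s; exact deriv_comp_add_const f u s
    rw [hd1, deriv_comp_add_const (deriv f) u 0, zero_add]
  have hbound' : ∀ u ∈ Icc 0 (2 * t), ‖deriv (deriv f) u‖ ≤ D := fun u hu => by
    rw [hsecond u]; exact hbound u hu
  have h := norm_line_secondDiff_le (f := f) (f' := deriv f) (f'' := deriv (deriv f)) ht
    (fun u hu => (hderiv u hu).1) (fun u hu => (hderiv u hu).2) hbound'
  have h0 : f 0 = fourierCoeff (𝒦 A₀) κ := by simp [hf]
  have h2 : (2 : ℝ) • f t = 2 * fourierCoeff (𝒦 (A₀ + t • B)) κ := by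
    rw [hf, Complex.real_smul]; norm_num
  rw [h0, h2] at h
  simpa [hf] using h

/-! ## The package: shell-wise second differences of the multipliers -/

section Package

variable {𝒞 : Matrix (Fin d) (Fin d) ℝ → ℕ → (Fin d → ZMod M) → ℝ} {c C : ℝ} {Cℓ : ℕ → ℝ}
    {Cα : (Fin d → ℕ) → ℕ → ℝ} {L N n ñ : ℕ}

/-- **Shell-wise second differences of `𝒞̂_{A,k}(κ)` along an elliptic segment** (clauses (iv), (v) of
`TorusFRD d`, `ℓ = 2`): for `B` unit symmetric, `T ≥ 0`, the segment `A₀ + sB`, `s ∈ [0,2T]`, in `𝓛(½,2)`,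
`1 ≤ k ≤ N+1`, `n ≤ ñ`, `κ ≠ 0` in shell `j`, and every `v ∈ [0, 2T]`:
`‖𝒞̂_{A₀+2TB,k}(κ) − 2𝒞̂_{A₀+TB,k}(κ) + 𝒞̂_{A₀,k}(κ)‖ ≤ (K⁽²⁾_j T²) · Re 𝒞̂_{A₀+vB,k}(κ)`,
`K⁽²⁾_j = shellRatioConst c (Cℓ 2) L d ñ / L^{(k−j)(ñ−n)}`.
[cite: Buchholz2016, Thm 4.5 (proof, (4.33))] -/
theorem norm_fourierCoeff_secondDiff_le_shell_of_torusFRD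
    (hiv : ∀ A : Matrix (Fin d) (Fin d) ℝ, IsElliptic (1 / 2 : ℝ) 2 A →
      ∀ k, 1 ≤ k → k ≤ N + 1 → ∀ B : Matrix (Fin d) (Fin d) ℝ, IsUnitSymm B →
        (∃ ε : ℝ, 0 < ε ∧ ∀ x : Fin d → ZMod M,
          ContDiffOn ℝ ⊤ (fun s : ℝ => 𝒞 (A + s • B) k x) (Set.Ioo (-ε) ε)) ∧
        ∀ α : Fin d → ℕ, ∑ i, α i ≤ n → ∀ ℓ : ℕ, ∀ x : Fin d → ZMod M,
          abs (iteratedDeriv ℓ (fun s : ℝ => GradientFRD.iterDiff α (𝒞 (A + s • B) k) x) 0)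
            ≤ Cα α ℓ / (L : ℝ) ^ ((k - 1) * (d - 2 + ∑ i, α i)))
    (hv : ∀ A : Matrix (Fin d) (Fin d) ℝ, IsElliptic (1 / 2 : ℝ) 2 A →
      ∀ k, 1 ≤ k → k ≤ N + 1 → ∀ j : ℕ, ∀ κ : Fin d → ZMod M, κ ≠ 0 → InShell L j κ →
        (j < k →
          c / (L : ℝ) ^ (2 * (d + ñ) + 1) * (L : ℝ) ^ (2 * j)
              / (L : ℝ) ^ ((k - j) * (d - 1 + n)) ≤ (fourierCoeff (𝒞 A k) κ).re ∧
          ‖fourierCoeff (𝒞 A k) κ‖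
            ≤ C * (L : ℝ) ^ (2 * (d + ñ) + 1) * (L : ℝ) ^ (2 * j)
                / (L : ℝ) ^ ((k - j) * (d - 1 + n))) ∧
        (k ≤ j →
          c / (L : ℝ) ^ (2 * (d + ñ) + 1) * (L : ℝ) ^ (2 * k)
              ≤ (fourierCoeff (𝒞 A k) κ).re ∧
          ‖fourierCoeff (𝒞 A k) κ‖ ≤ C * (L : ℝ) ^ (2 * k)) ∧
        ∀ B : Matrix (Fin d) (Fin d) ℝ, IsUnitSymm B → ∀ ℓ : ℕ, 1 ≤ ℓ →
          (j < k →
            ‖iteratedDeriv ℓ (fun s : ℝ => fourierCoeff (𝒞 (A + s • B) k) κ) 0‖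
              ≤ Cℓ ℓ * (L : ℝ) ^ (2 * (d + ñ) + 1) * (L : ℝ) ^ (2 * j)
                  / (L : ℝ) ^ ((k - j) * (d - 1 + ñ))) ∧
          (k ≤ j →
            ‖iteratedDeriv ℓ (fun s : ℝ => fourierCoeff (𝒞 (A + s • B) k) κ) 0‖
              ≤ Cℓ ℓ * (L : ℝ) ^ (2 * k)))
    (hc : 0 < c) (hC2 : 0 ≤ Cℓ 2) (hL : 1 ≤ L) (hnñ : n ≤ ñ)
    {A₀ B : Matrix (Fin d) (Fin d) ℝ} (hB : IsUnitSymm B) {T : ℝ} (hT : 0 ≤ T)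
    (hell : ∀ t ∈ Icc 0 (2 * T), IsElliptic (1 / 2 : ℝ) 2 (A₀ + t • B))
    {k : ℕ} (hk1 : 1 ≤ k) (hkN : k ≤ N + 1) {κ : Fin d → ZMod M} (hκ : κ ≠ 0) {j : ℕ}
    (hj : InShell L j κ) {v : ℝ} (hvI : v ∈ Icc 0 (2 * T)) :
    ‖fourierCoeff (𝒞 (A₀ + (2 * T) • B) k) κ - 2 * fourierCoeff (𝒞 (A₀ + T • B) k) κ + fourierCoeff (𝒞 A₀ k) κ‖ ≤
      (shellRatioConst c (Cℓ 2) (L : ℝ) d ñ / (L : ℝ) ^ ((k - j) * (ñ - n)) * T ^ 2) *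
        (fourierCoeff (𝒞 (A₀ + v • B) k) κ).re := by
  have hLr : (1 : ℝ) ≤ (L : ℝ) := by exact_mod_cast hL
  have hL0 : (0 : ℝ) < (L : ℝ) := by linarith
  have hK : 0 ≤ shellRatioConst c (Cℓ 2) (L : ℝ) d ñ / (L : ℝ) ^ ((k - j) * (ñ - n)) :=
    shellRatio_div_nonneg hc hC2 hL0.le d n ñ k j
  -- smoothness along the segment (clause (iv))
  have hsmooth : ∀ u ∈ Icc 0 (2 * T), ∃ ε : ℝ, 0 < ε ∧ ∀ y,
      ContDiffOn ℝ ⊤ (fun s : ℝ => (fun A => 𝒞 A k) (A₀ + u • B + s • B) y) (Ioo (-ε) ε) :=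
    fun u hu => (hiv _ (hell u hu) k hk1 hkN B hB).1
  rcases lt_or_ge j k with hjk | hkj
  · -- shells `j < k`
    set lower : ℝ := c / (L : ℝ) ^ (2 * (d + ñ) + 1) * (L : ℝ) ^ (2 * j) / (L : ℝ) ^ ((k - j) * (d - 1 + n))
      with hlower
    set upper : ℝ := Cℓ 2 * (L : ℝ) ^ (2 * (d + ñ) + 1) * (L : ℝ) ^ (2 * j) / (L : ℝ) ^ ((k - j) * (d - 1 + ñ))
      with hupper
    have hup : ∀ u ∈ Icc 0 (2 * T),
        ‖iteratedDeriv 2 (fun s : ℝ => fourierCoeff ((fun A => 𝒞 A k) (A₀ + u • B + s • B)) κ) 0‖ ≤ upper :=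
      fun u hu => ((hv (A₀ + u • B) (hell u hu) k hk1 hkN j κ hκ hj).2.2 B hB 2 (by norm_num)).1 hjk
    have hlow : lower ≤ (fourierCoeff (𝒞 (A₀ + v • B) k) κ).re :=
      ((hv (A₀ + v • B) (hell v hvI) k hk1 hkN j κ hκ hj).1 hjk).1
    have hratio : upper ≤ (shellRatioConst c (Cℓ 2) (L : ℝ) d ñ / (L : ℝ) ^ ((k - j) * (ñ - n))) * lower :=
      deriv_shell_bound_le_ratio_div_mul_lower_lt hc hLr hnñ
    have hmv := norm_fourierCoeff_segment_secondDiff_le (𝒦 := fun A => 𝒞 A k) (A₀ := A₀) hT κ hsmooth hup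
    calc ‖fourierCoeff (𝒞 (A₀ + (2 * T) • B) k) κ - 2 * fourierCoeff (𝒞 (A₀ + T • B) k) κ + fourierCoeff (𝒞 A₀ k) κ‖
        ≤ upper * T ^ 2 := hmv
      _ ≤ (shellRatioConst c (Cℓ 2) (L : ℝ) d ñ / (L : ℝ) ^ ((k - j) * (ñ - n)) * lower) * T ^ 2 :=
          mul_le_mul_of_nonneg_right hratio (sq_nonneg _)
      _ ≤ (shellRatioConst c (Cℓ 2) (L : ℝ) d ñ / (L : ℝ) ^ ((k - j) * (ñ - n)) *
            (fourierCoeff (𝒞 (A₀ + v • B) k) κ).re) * T ^ 2 :=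
          mul_le_mul_of_nonneg_right (mul_le_mul_of_nonneg_left hlow hK) (sq_nonneg _)
      _ = _ := by ring
  · -- shells `k ≤ j`
    set lower : ℝ := c / (L : ℝ) ^ (2 * (d + ñ) + 1) * (L : ℝ) ^ (2 * k) with hlower
    set upper : ℝ := Cℓ 2 * (L : ℝ) ^ (2 * k) with hupper
    have hup : ∀ u ∈ Icc 0 (2 * T),
        ‖iteratedDeriv 2 (fun s : ℝ => fourierCoeff ((fun A => 𝒞 A k) (A₀ + u • B + s • B)) κ) 0‖ ≤ upper :=
      fun u hu => ((hv (A₀ + u • B) (hell u hu) k hk1 hkN j κ hκ hj).2.2 B hB 2 (by norm_num)).2 hkj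
    have hlow : lower ≤ (fourierCoeff (𝒞 (A₀ + v • B) k) κ).re :=
      ((hv (A₀ + v • B) (hell v hvI) k hk1 hkN j κ hκ hj).2.1 hkj).1
    have hratio : upper ≤ (shellRatioConst c (Cℓ 2) (L : ℝ) d ñ / (L : ℝ) ^ ((k - j) * (ñ - n))) * lower := by
      rw [shellRatio_div_of_le hkj]
      exact deriv_shell_bound_le_ratio_mul_lower_le hc hC2 hLr
    have hmv := norm_fourierCoeff_segment_secondDiff_le (𝒦 := fun A => 𝒞 A k) (A₀ := A₀) hT κ hsmooth hup
    calc ‖fourierCoeff (𝒞 (A₀ + (2 * T) • B) k) κ - 2 * fourierCoeff (𝒞 (A₀ + T • B) k) κ + fourierCoeff (𝒞 A₀ k) κ‖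
        ≤ upper * T ^ 2 := hmv
      _ ≤ (shellRatioConst c (Cℓ 2) (L : ℝ) d ñ / (L : ℝ) ^ ((k - j) * (ñ - n)) * lower) * T ^ 2 :=
          mul_le_mul_of_nonneg_right hratio (sq_nonneg _)
      _ ≤ (shellRatioConst c (Cℓ 2) (L : ℝ) d ñ / (L : ℝ) ^ ((k - j) * (ñ - n)) *
            (fourierCoeff (𝒞 (A₀ + v • B) k) κ).re) * T ^ 2 :=
          mul_le_mul_of_nonneg_right (mul_le_mul_of_nonneg_left hlow hK) (sq_nonneg _)
      _ = _ := by ring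

/-- **Shell-wise second differences of `𝒞̂_{1+q,k}(κ)` along a line of tuning parameters**: for symmetric
`q`, `h` with `Σ|q| ≤ ½` and `Σ|q + 2h| ≤ ½` (then the segment through `1+q, 1+q+h, 1+q+2h` is elliptic),
`1 ≤ k ≤ N+1`, `T = Σ|h|`, `K⁽²⁾_j = shellRatioConst c (Cℓ 2) L d ñ / L^{(k−j)(ñ−n)}`, and `κ ≠ 0` in shell `j`:
`‖𝒞̂_{1+q+2h,k}(κ) − 2𝒞̂_{1+q+h,k}(κ) + 𝒞̂_{1+q,k}(κ)‖ ≤ (K⁽²⁾_j T²)·Re 𝒞̂_{1+p,k}(κ)` for each of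
`p = q, q + h, q + 2h`. [cite: AdamsBuchholzKoteckyMuller2019, Lemma 12.6 / Theorem 6.1 (v)] -/
theorem norm_fourierCoeff_one_add_line_secondDiff_le_shell_of_torusFRD
    (hiv : ∀ A : Matrix (Fin d) (Fin d) ℝ, IsElliptic (1 / 2 : ℝ) 2 A →
      ∀ k, 1 ≤ k → k ≤ N + 1 → ∀ B : Matrix (Fin d) (Fin d) ℝ, IsUnitSymm B →
        (∃ ε : ℝ, 0 < ε ∧ ∀ x : Fin d → ZMod M,
          ContDiffOn ℝ ⊤ (fun s : ℝ => 𝒞 (A + s • B) k x) (Set.Ioo (-ε) ε)) ∧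
        ∀ α : Fin d → ℕ, ∑ i, α i ≤ n → ∀ ℓ : ℕ, ∀ x : Fin d → ZMod M,
          abs (iteratedDeriv ℓ (fun s : ℝ => GradientFRD.iterDiff α (𝒞 (A + s • B) k) x) 0)
            ≤ Cα α ℓ / (L : ℝ) ^ ((k - 1) * (d - 2 + ∑ i, α i)))
    (hv : ∀ A : Matrix (Fin d) (Fin d) ℝ, IsElliptic (1 / 2 : ℝ) 2 A →
      ∀ k, 1 ≤ k → k ≤ N + 1 → ∀ j : ℕ, ∀ κ : Fin d → ZMod M, κ ≠ 0 → InShell L j κ →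
        (j < k →
          c / (L : ℝ) ^ (2 * (d + ñ) + 1) * (L : ℝ) ^ (2 * j)
              / (L : ℝ) ^ ((k - j) * (d - 1 + n)) ≤ (fourierCoeff (𝒞 A k) κ).re ∧
          ‖fourierCoeff (𝒞 A k) κ‖
            ≤ C * (L : ℝ) ^ (2 * (d + ñ) + 1) * (L : ℝ) ^ (2 * j)
                / (L : ℝ) ^ ((k - j) * (d - 1 + n))) ∧
        (k ≤ j →
          c / (L : ℝ) ^ (2 * (d + ñ) + 1) * (L : ℝ) ^ (2 * k)
              ≤ (fourierCoeff (𝒞 A k) κ).re ∧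
          ‖fourierCoeff (𝒞 A k) κ‖ ≤ C * (L : ℝ) ^ (2 * k)) ∧
        ∀ B : Matrix (Fin d) (Fin d) ℝ, IsUnitSymm B → ∀ ℓ : ℕ, 1 ≤ ℓ →
          (j < k →
            ‖iteratedDeriv ℓ (fun s : ℝ => fourierCoeff (𝒞 (A + s • B) k) κ) 0‖
              ≤ Cℓ ℓ * (L : ℝ) ^ (2 * (d + ñ) + 1) * (L : ℝ) ^ (2 * j)
                  / (L : ℝ) ^ ((k - j) * (d - 1 + ñ))) ∧
          (k ≤ j →
            ‖iteratedDeriv ℓ (fun s : ℝ => fourierCoeff (𝒞 (A + s • B) k) κ) 0‖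
              ≤ Cℓ ℓ * (L : ℝ) ^ (2 * k)))
    (hc : 0 < c) (hC2 : 0 ≤ Cℓ 2) (hL : 1 ≤ L) (hnñ : n ≤ ñ)
    {q h : Matrix (Fin d) (Fin d) ℝ} (hq : q.IsSymm) (hh : h.IsSymm)
    (hq2 : ∑ i, ∑ j, |q i j| ≤ 1 / 2) (hq2h2 : ∑ i, ∑ j, |(q + (2 : ℝ) • h) i j| ≤ 1 / 2)
    {k : ℕ} (hk1 : 1 ≤ k) (hkN : k ≤ N + 1) {κ : Fin d → ZMod M} (hκ : κ ≠ 0) {j : ℕ}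
    (hj : InShell L j κ) {p : Matrix (Fin d) (Fin d) ℝ} (hp : p = q ∨ p = q + h ∨ p = q + (2 : ℝ) • h) :
    ‖fourierCoeff (𝒞 ((1 : Matrix (Fin d) (Fin d) ℝ) + (q + (2 : ℝ) • h)) k) κ -
        2 * fourierCoeff (𝒞 ((1 : Matrix (Fin d) (Fin d) ℝ) + (q + h)) k) κ +
        fourierCoeff (𝒞 ((1 : Matrix (Fin d) (Fin d) ℝ) + q) k) κ‖ ≤
      (shellRatioConst c (Cℓ 2) (L : ℝ) d ñ / (L : ℝ) ^ ((k - j) * (ñ - n)) * (∑ i, ∑ j, |h i j|) ^ 2) *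
        (fourierCoeff (𝒞 ((1 : Matrix (Fin d) (Fin d) ℝ) + p) k) κ).re := by
  set T := ∑ i, ∑ j, |h i j| with hTdef
  have hT0 : 0 ≤ T := sum_nonneg fun _ _ => sum_nonneg fun _ _ => abs_nonneg _
  rcases hT0.eq_or_lt with hTz | hTpos
  · -- `h = 0`
    have hh0 : h = 0 := by
      ext i j
      have hle : |h i j| ≤ T :=
        (single_le_sum (f := fun j => |h i j|) (fun _ _ => abs_nonneg _) (mem_univ j)).trans
          (single_le_sum (f := fun i => ∑ j, |h i j|) (fun _ _ => sum_nonneg fun _ _ => abs_nonneg _)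
            (mem_univ i))
      have : |h i j| = 0 := le_antisymm (hTz ▸ hle) (abs_nonneg _)
      simpa using this
    subst hh0
    have e : fourierCoeff (𝒞 ((1 : Matrix (Fin d) (Fin d) ℝ) + (q + (2 : ℝ) • (0 : Matrix (Fin d) (Fin d) ℝ))) k) κ -
        2 * fourierCoeff (𝒞 ((1 : Matrix (Fin d) (Fin d) ℝ) + (q + 0)) k) κ +
        fourierCoeff (𝒞 ((1 : Matrix (Fin d) (Fin d) ℝ) + q) k) κ = 0 := by
      rw [smul_zero, add_zero]; ring
    rw [e, norm_zero, ← hTz]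
    simp
  · -- a genuine direction
    set B : Matrix (Fin d) (Fin d) ℝ := T⁻¹ • h with hBdef
    have hBu : IsUnitSymm B := isUnitSymm_inv_smul hh hTpos le_rfl
    have hq2hs : (q + (2 : ℝ) • h).IsSymm := hq.add (hh.smul _)
    have hseg := isElliptic_segment_of_entrySum_le (m := q) (m' := q + (2 : ℝ) • h) hq hq2hs hq2 hq2h2
      (T := 2 * T) (by linarith)
    have hdir : (2 * T)⁻¹ • (q + (2 : ℝ) • h - q) = B := by
      rw [add_sub_cancel_left, smul_smul, hBdef]
      congr 1
      field_simp
    rw [hdir] at hseg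
    have hTB : T • B = h := by rw [hBdef, smul_smul, mul_inv_cancel₀ hTpos.ne', one_smul]
    have h2TB : (2 * T) • B = (2 : ℝ) • h := by rw [mul_smul, hTB]
    -- the comparison point
    obtain ⟨v, hvI, hvp⟩ : ∃ v ∈ Icc (0 : ℝ) (2 * T), (1 : Matrix (Fin d) (Fin d) ℝ) + q + v • B = 1 + p := by
      rcases hp with hp | hp | hp
      · exact ⟨0, ⟨le_rfl, by linarith⟩, by rw [hp, zero_smul, add_zero]⟩
      · exact ⟨T, ⟨hT0, by linarith⟩, by rw [hp, hTB, add_assoc]⟩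
      · exact ⟨2 * T, ⟨by linarith, le_rfl⟩, by rw [hp, h2TB, add_assoc]⟩
    have hmain := norm_fourierCoeff_secondDiff_le_shell_of_torusFRD hiv hv hc hC2 hL hnñ hBu hT0 hseg hk1 hkN hκ hj hvI
    rw [hvp, h2TB, hTB, add_assoc, add_assoc] at hmain
    exact hmain

end Package

end Literature.MathematicalPhysics.StatisticalMechanics.GradientRG

end
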